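import Literature.Geometry.Lorentzian.FinalEraPackage2
import Summits.FinalStateConjecture.FinalStateConjecture.Statement
import HarnessLib

/-!
# Stub `stub_pairLedger` (v3-S1c) of line `dilated-leaves-virial-certificate` of crux `Capture`
# (stmt-FinalStateConjecture-10115): the `N ≤ 1` sector (vacuous pair ledgers)

The line `dilated-leaves-virial-certificate` of the crux `Capture` (routes `BartnikGapSettling` /
`QuietWindowCapture`, summit `FinalStateConjecture`; skeleton
`Summits/FinalStateConjecture/FinalStateConjecture/Cruxes/Capture/Lines/dilated_leaves_virial_certificate.lean`,
v3) reads the crux as: near-sub-extremal-Kerr leaves ⇒ a rev-2 final-era package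
`p : FinalEraPackage₂ 𝒟` (S1a, era entry) ⇒ for `p.N ≤ 2`, PAIR LEDGER RE-FRAMING (S1c,
`stub_pairLedger`: trade `p` for a package `p'` with `≤ 2` holes carrying PAIR LEDGERS — for every
pair `i ≠ j` a slack constant `κ' ≥ 0`, a forcing `β' ≥ 0` with `t²β' → 0`, the RELATIVE
Einstein–Infeld–Hoffmann law for `x = ξᵢ − ξⱼ`, `μ = Mᵢ + Mⱼ` with the `κ'`-bracket in relative
velocity, and an energy ledger `E` antitone on `[T, ∞)`, PN-relatively accurate against
`‖x'‖²/2 − μ/‖x‖`) ⇒ registration (S1b) ⇒ pairwise recurrence (S2, landed) ⇒ two-body escape and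
pair dispersal (S3/S4, landed) ⇒ settles (S6 ≡ stmt-FinalStateConjecture-10994).

The OWN content of S1c sits exactly at `N = 2` and is general-relativistic (intended witness: the
same two holes re-charted in the flat frame of the pair's terminal centre of momentum, `E` = Bondi
energy minus `M₀ + M₁`; Bondi mass loss and "Bondi energy = `1PN` binding energy of a resolved
pair", Blanchet, Living Rev. Relativ. 27 (2024), §3.2.2) — not a theorem anywhere, and not
derivable from the clauses of a GIVEN package (its modulation clause (W4) brackets ABSOLUTE
velocities, its forcing `β` is only `L¹`, and it has no energy clause; the `κ`-pumped Kepler ladder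
is consistent with all clauses — wave-1 pair-sector audit recorded in the skeleton's docstring).

This file proves, kernel-checked, the sector in which S1c is VACUOUS: for a package with at most
ONE hole (`p.N ≤ 1`) take `p' := p`; then `Fin p'.N` has at most one element, so the pair
quantifier `∀ i j, i ≠ j → …` is empty (`Fin.ext` + `omega`).  The theorem
`stub_pairLedger_of_N_le_one` is the registered signature of `stub_pairLedger` VERBATIM with the
single change `p.N ≤ 2 →` ↦ `p.N ≤ 1 →` in the hypothesis (registered helper sub-goal of the crux
item).  No definitions, no named facts, no `Theses` import.

References: Blanchet, Living Rev. Relativ. 27 (2024), §3.2.2; Dafermos–Luk arXiv:1710.01722, p. 8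
(the final-era picture).
-/

-- the doubled `FinalStateConjecture.FinalStateConjecture` path component trips dupNamespace
set_option linter.dupNamespace false

noncomputable section

namespace Summit.FinalStateConjecture.FinalStateConjecture.Theorems.BartnikGapSettling.Capture

open Set Filter Function Topology
open scoped Manifold ContDiff ENNReal BigOperators
open Literature.Geometry.Lorentzian

/-- **Stub S1c in the sector `N ≤ 1`** (registered signature of `stub_pairLedger` verbatim, with the
hypothesis `p.N ≤ 2` strengthened to `p.N ≤ 1`): a rev-2 final-era package with at most one hole is
its own pair-ledger re-framing — take `p' := p`; `p'.N ≤ 2` by `omega`, and the pair clause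
`∀ i j, i ≠ j → …` over `Fin p.N` is vacuous since any two elements of `Fin p.N`, `p.N ≤ 1`, are
equal (`Fin.ext`, `omega`).  The GR content of S1c is exactly the complementary case `p.N = 2`.
[folklore] -/
theorem stub_pairLedger_of_N_le_one :
    ∀ (X : Type) [TopologicalSpace X] [ChartedSpace E3 X] [IsManifold (𝓡 3) ∞ X] [T2Space X]
      [SecondCountableTopology X] [ConnectedSpace X],
      ∀ D ∈ admissibleVacuumData X, ∀ 𝒟 : VacuumCauchyDevelopment D, 𝒟.IsMaximal →
        Summit.FinalStateConjecture.HasCompleteNullInfinity 𝒟.toCauchyDevelopment →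
          ∀ p : FinalEraPackage₂ 𝒟.toCauchyDevelopment, p.N ≤ 1 →
            ∃ p' : FinalEraPackage₂ 𝒟.toCauchyDevelopment, p'.N ≤ 2 ∧
              ∀ i j, i ≠ j → ∃ (κ' : ℝ) (β' E : ℝ → ℝ), 0 ≤ κ' ∧
                (∀ t, p'.T ≤ t → 0 ≤ β' t) ∧ Tendsto (fun t ↦ t ^ 2 * β' t) atTop (𝓝 0) ∧
                (∀ t, p'.T ≤ t →
                  ‖deriv (deriv (p'.ξ i - p'.ξ j)) t +
                      ((p'.M i + p'.M j) / ‖p'.ξ i t - p'.ξ j t‖ ^ 3) • (p'.ξ i t - p'.ξ j t)‖ ≤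
                    κ' * ((p'.M i + p'.M j) / ‖p'.ξ i t - p'.ξ j t‖ ^ 2 *
                      (‖deriv (p'.ξ i - p'.ξ j) t‖ ^ 2 +
                        (p'.M i + p'.M j) / ‖p'.ξ i t - p'.ξ j t‖)) + β' t) ∧
                AntitoneOn E (Ici p'.T) ∧
                (∀ t, p'.T ≤ t →
                  |E t - (‖deriv (p'.ξ i - p'.ξ j) t‖ ^ 2 / 2 -
                      (p'.M i + p'.M j) / ‖p'.ξ i t - p'.ξ j t‖)| ≤
                    κ' * (‖deriv (p'.ξ i - p'.ξ j) t‖ ^ 2 +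
                        (p'.M i + p'.M j) / ‖p'.ξ i t - p'.ξ j t‖) *
                      ((p'.M i + p'.M j) / ‖p'.ξ i t - p'.ξ j t‖)) := by
  intro X _ _ _ _ _ _ D _ 𝒟 _ _ p hN
  refine ⟨p, by omega, fun i j hij ↦ ?_⟩
  have hi := i.isLt
  have hj := j.isLt
  exact absurd (Fin.ext (by omega)) hij

end Summit.FinalStateConjecture.FinalStateConjecture.Theorems.BartnikGapSettling.Capture

end
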